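import Mathlib.LinearAlgebra.BilinearForm.Properties
import Mathlib.LinearAlgebra.BilinearForm.IsometryEquiv
import Mathlib.LinearAlgebra.PerfectPairing.Basic
import Mathlib.LinearAlgebra.QuadraticForm.Signature
import Mathlib.LinearAlgebra.SesquilinearForm.Basic
import Mathlib.LinearAlgebra.Matrix.Cartan
import Mathlib.LinearAlgebra.Matrix.BilinearForm
import Mathlib.LinearAlgebra.FreeModule.Basic
import HarnessLib

-- provenance: harness21/H21/H21/Prelude/FourManM/LatticeForms.lean @ 4d2e698 (interim HEAD d8f2665); M5 mechanical rewrite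
/-!
# Integral lattices: unimodularity, parity, signature, definiteness (trunk T-4MAN)

Vocabulary for symmetric bilinear forms `Q : LinearMap.BilinForm ℤ V` on a `ℤ`-module `V`
(typically free of finite rank: an *integral lattice*), as consumed by the intersection-form layer
of the 4-manifold statements (Freedman, Donaldson, Rokhlin, 11/8).

## Informal content

For a symmetric bilinear form `Q` on a finitely generated free abelian group:
* `Q` is *unimodular* if `x ↦ Q x -` is an isomorphism `V ≃ Hom(V, ℤ)`, equivalently the Gram matrix
  in any basis has determinant `±1`;
* `Q` is *even* (type II) if `Q x x` is even for all `x`, *odd* (type I) otherwise;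
* the *signature* `σ(Q) = b⁺ - b⁻` where `b⁺` (resp. `b⁻`) is the maximal rank of a sublattice on which
  `Q` is positive (resp. negative) definite;
* `Q` is *definite* if it is positive or negative definite, *indefinite* otherwise;
* `Q` is *diagonalisable* over `ℤ` if `V` has a `Q`-orthogonal basis.
Standard facts stated here: van der Blij's lemma `8 ∣ σ(Q)` for even unimodular `Q`, and the
classification of indefinite unimodular forms by rank, signature and type (Serre).
Concrete forms: the `E₈` form (Gram matrix the Cartan matrix of `E₈`; even, positive definite,
unimodular, signature `8`) and the hyperbolic plane `H` (Gram matrix `!![0, 1; 1, 0]`).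

## Sources

* J. Milnor, D. Husemoller, *Symmetric bilinear forms* (1973), Ch. I §1–§5, Ch. II §2–§5
  (II.5.3: classification of indefinite unimodular forms; II.5.1–5.2: van der Blij).
* J.-P. Serre, *Cours d'arithmétique* (1970), Ch. V.

## Mathlib

Used as is (not redefined): `LinearMap.BilinForm`, `LinearMap.BilinForm.IsSymm`,
`LinearMap.BilinForm.Nondegenerate`, `LinearMap.BilinForm.Equivalent` (isometry classes),
`LinearMap.IsPerfPair` (perfect pairings), root-namespace `sigPos`/`sigNeg`
(`Mathlib/LinearAlgebra/QuadraticForm/Signature.lean`, valid over any linearly ordered commutative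
ring, in particular `ℤ`), `QuadraticMap.PosDef`, `LinearMap.IsOrthoᵢ`, `LinearMap.BilinForm.toMatrix`,
`Matrix.toBilin'`, `CartanMatrix.E₈`.

## Design choices

* The predicates live in `namespace LinearMap.BilinForm`: this is a **deliberate dot-notation
  extension of a Mathlib namespace** (so that one writes `Q.IsUnimodular`, `Q.signature`, ...).
  None of the names introduced clashes with a Mathlib declaration (checked: there is no
  `LinearMap.BilinForm.PosDef`, `.IsEven`, `.signature`, `.IsUnimodular` in Mathlib).
  The concrete forms `e8Form`, `hyperbolicForm` live in `namespace Literature`.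
* `IsUnimodular Q := Q.IsPerfPair` (Mathlib's Prop-valued class): both `x ↦ Q x -` and `y ↦ Q - y`
  are bijective. `isUnimodular_iff_isUnit_det` relates it to the Gram determinant.
* **Junk value of `signature`.** Mathlib's `sigPos Q` is the maximum of the ranks `≤ finrank ℤ V` of
  positive definite submodules; when `V` is not finitely generated `finrank ℤ V = 0` and hence
  `sigPos = sigNeg = 0` and `signature Q = 0`. The signature is only meaningful under
  `[Module.Finite ℤ V]` (and `[Module.Free ℤ V]` for lattices).
* **The zero lattice is definite** (`PosDef` holds vacuously on the zero module) and is diagonalised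
  by the empty basis; thus Donaldson's theorem applied to `S⁴` (zero second homology) is consistent.
* `PosDef` follows the Mathlib spelling (`QuadraticMap.PosDef`, `Matrix.PosDef`) rather than
  `IsPosDef`.
* **Predicates carry an explicit binder `(Q : LinearMap.BilinForm ℤ V)`** (`IsUnimodular`,
  `IsEven`, `IsOdd`, `PosDef`, `NegDef`, `IsDefinite`, `IsIndefinite`, `IsDiagonalizable`, and the
  `ℤ`-valued `signature`) rather than taking `Q` from a `variable` line: the elaborated
  declarations are the same (`{V} [AddCommGroup V] [Module ℤ V] (Q) : Prop`), but a *definition*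
  (a predicate on forms, false for some `Q` — e.g. the zero form on `ℤ` is not unimodular, see
  `not_isUnimodular_zero` in `LatticeFormsProofs.lean`) is thereby textually distinguished from a
  *named fact* `def X : Prop := ∀ …` (a closed published statement awaiting `X_holds`, such as
  `eight_dvd_signature_of_isEven`), which is how the harness census reads this file.
-/

noncomputable section

open Module

namespace LinearMap.BilinForm

variable {V V' : Type*} [AddCommGroup V] [Module ℤ V] [AddCommGroup V'] [Module ℤ V']

/-- A bilinear form `Q` on a `ℤ`-module is *unimodular* if it is a perfect pairing: both
`x ↦ Q x -` and `y ↦ Q - y` are bijections `V → (V →ₗ[ℤ] ℤ)`. For a lattice this says the Gram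
matrix has determinant `±1` (`isUnimodular_iff_isUnit_det`).
Milnor–Husemoller (1973), I §1–§2. Defined via Mathlib's `LinearMap.IsPerfPair`. [cite: MilnorHusemoller1973] -/
def IsUnimodular (Q : LinearMap.BilinForm ℤ V) : Prop := Q.IsPerfPair

/-- A bilinear form `Q` on a `ℤ`-module is *even* (of type II) if `Q x x` is even for every `x`.
Milnor–Husemoller (1973), I §3; Serre, *Cours d'arithmétique* V.1.3. [cite: MilnorHusemoller1973] -/
def IsEven (Q : LinearMap.BilinForm ℤ V) : Prop := ∀ x, Even (Q x x)

/-- A bilinear form `Q` on a `ℤ`-module is *odd* (of type I) if it is not even, i.e. some `Q x x`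
is odd. Milnor–Husemoller (1973), I §3. [cite: MilnorHusemoller1973] -/
def IsOdd (Q : LinearMap.BilinForm ℤ V) : Prop := ¬ Q.IsEven

/-- The *signature* `σ(Q) = b⁺(Q) - b⁻(Q)` of a bilinear form on a `ℤ`-module, where `b⁺` (resp. `b⁻`)
is the maximal rank of a submodule on which the associated quadratic map `x ↦ Q x x` is positive
(resp. negative) definite (Mathlib's `sigPos`/`sigNeg`).
**Junk value:** if `V` is not finitely generated then `finrank ℤ V = 0`, so `sigPos = sigNeg = 0`
and the signature is `0`; it is meaningful only for `[Module.Finite ℤ V]`.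
Milnor–Husemoller (1973), I §1 and II §2. [cite: MilnorHusemoller1973] -/
def signature (Q : LinearMap.BilinForm ℤ V) : ℤ :=
  (sigPos Q.toQuadraticMap : ℤ) - sigNeg Q.toQuadraticMap

/-- A bilinear form `Q` on a `ℤ`-module is *positive definite* if `0 < Q x x` for all `x ≠ 0`
(Mathlib's `QuadraticMap.PosDef` of the associated quadratic map). The zero module is (vacuously)
positive definite. Milnor–Husemoller (1973), I §1. [cite: MilnorHusemoller1973] -/
def PosDef (Q : LinearMap.BilinForm ℤ V) : Prop := Q.toQuadraticMap.PosDef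

/-- A bilinear form `Q` on a `ℤ`-module is *negative definite* if `-Q` is positive definite.
Milnor–Husemoller (1973), I §1. [cite: MilnorHusemoller1973] -/
def NegDef (Q : LinearMap.BilinForm ℤ V) : Prop := (-Q).PosDef

/-- A bilinear form is *definite* if it is positive definite or negative definite. Note that the
zero lattice is definite. Milnor–Husemoller (1973), II §2. [cite: MilnorHusemoller1973] -/
def IsDefinite (Q : LinearMap.BilinForm ℤ V) : Prop := Q.PosDef ∨ Q.NegDef

/-- A bilinear form is *indefinite* if it is neither positive nor negative definite.
Milnor–Husemoller (1973), II §2. [cite: MilnorHusemoller1973] -/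
def IsIndefinite (Q : LinearMap.BilinForm ℤ V) : Prop := ¬ Q.IsDefinite

/-- A bilinear form `Q` on a `ℤ`-module `V` is *diagonalisable over `ℤ`* if `V` admits a
`Q`-orthogonal `ℤ`-basis (Mathlib's `LinearMap.IsOrthoᵢ`). For a unimodular form this says
`Q ≅ ⊕ ⟨±1⟩`; the zero lattice is diagonalised by the empty basis.
Milnor–Husemoller (1973), I §3; Donaldson (1983). [cite: MilnorHusemoller1973] -/
def IsDiagonalizable (Q : LinearMap.BilinForm ℤ V) : Prop :=
  ∃ (ι : Type) (b : Basis ι ℤ V), LinearMap.IsOrthoᵢ Q b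

variable (Q : LinearMap.BilinForm ℤ V) (Q' : LinearMap.BilinForm ℤ V')

/-- Unfolding lemma: `Q` is positive definite iff `0 < Q x x` for all `x ≠ 0`.
Milnor–Husemoller (1973), I §1. [cite: MilnorHusemoller1973] -/
lemma posDef_iff : Q.PosDef ↔ ∀ x, x ≠ 0 → 0 < Q x x := Iff.rfl

/-- Unfolding lemma: `Q` is negative definite iff `Q x x < 0` for all `x ≠ 0`.
Milnor–Husemoller (1973), I §1. [cite: MilnorHusemoller1973] -/
lemma negDef_iff : Q.NegDef ↔ ∀ x, x ≠ 0 → Q x x < 0 := by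
  simp only [NegDef, posDef_iff, LinearMap.neg_apply, Left.neg_pos_iff]

/-- Unfolding lemma: `Q` is indefinite iff it is neither positive nor negative definite.
Milnor–Husemoller (1973), II §2. [cite: MilnorHusemoller1973] -/
lemma isIndefinite_iff : Q.IsIndefinite ↔ ¬ Q.PosDef ∧ ¬ Q.NegDef := not_or

/-- A form on a lattice is unimodular iff its Gram matrix in some (any) basis has unit
determinant (`±1`). Milnor–Husemoller (1973), I §2, Lemma 2.1 ff. [cite: MilnorHusemoller1973] -/
def isUnimodular_iff_isUnit_det : Prop :=
  ∀ {ι : Type*} [Fintype ι] [DecidableEq ι] (b : Basis ι ℤ V),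
    Q.IsUnimodular ↔ IsUnit (BilinForm.toMatrix b Q).det

/-- The signature changes sign with the form: `σ(-Q) = -σ(Q)`. Milnor–Husemoller (1973), II §2. [cite: MilnorHusemoller1973] -/
theorem signature_neg : (-Q).signature = -Q.signature := by
  simp only [signature]
  have h : (-Q).toQuadraticMap = -Q.toQuadraticMap := rfl
  rw [h, sigPos_neg, sigNeg_neg]
  ring

variable {Q Q'}

/-- Isometric forms have the same signature. Milnor–Husemoller (1973), II §2. [cite: MilnorHusemoller1973] -/
theorem signature_eq_of_equivalent (h : Q.Equivalent Q') : Q.signature = Q'.signature := by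
  obtain ⟨e⟩ := h
  have hq : Q.toQuadraticMap.Equivalent Q'.toQuadraticMap :=
    ⟨{ e.toLinearEquiv with map_app' := fun x ↦ by simp }⟩
  simp only [signature, hq.sigPos_eq, hq.sigNeg_eq]

/-- Isometric forms have the same parity (type). Milnor–Husemoller (1973), I §3. [cite: MilnorHusemoller1973] -/
theorem isEven_iff_of_equivalent (h : Q.Equivalent Q') : Q.IsEven ↔ Q'.IsEven := by
  obtain ⟨e⟩ := h
  exact ⟨fun H x ↦ by simpa using H (e.symm x), fun H x ↦ by simpa using H (e x)⟩

/-- Unimodularity is invariant under isometry. Milnor–Husemoller (1973), I §2. [cite: MilnorHusemoller1973] -/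
theorem isUnimodular_of_equivalent (h : Q.Equivalent Q') (hQ : Q.IsUnimodular) :
    Q'.IsUnimodular := by
  obtain ⟨e⟩ := h
  have hQ' : Q' = Q.compl₁₂ e.symm.toLinearMap e.symm.toLinearMap := by
    ext x y
    simp
  rw [hQ']
  unfold IsUnimodular at hQ ⊢
  exact LinearMap.IsPerfPair.compl₁₂ Q e.symm.toLinearEquiv e.symm.toLinearEquiv

/-- For a symmetric unimodular form on a lattice, `b⁺ + b⁻ = rank`: a unimodular form is
nondegenerate over `ℚ`, so Sylvester's law of inertia leaves no zero part.
Milnor–Husemoller (1973), I §1 and II §2. [cite: MilnorHusemoller1973] -/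
def sigPos_add_sigNeg_eq_finrank : Prop :=
  ∀ [Module.Finite ℤ V] [Module.Free ℤ V] (hu : Q.IsUnimodular) (hs : Q.IsSymm),
    sigPos Q.toQuadraticMap + sigNeg Q.toQuadraticMap = finrank ℤ V

/-- **van der Blij's lemma.** The signature of an even symmetric unimodular lattice is divisible
by `8`. Milnor–Husemoller (1973), II (5.1)–(5.2); Serre, *Cours d'arithmétique* V.2, Thm 2 Cor 1. [cite: MilnorHusemoller1973] -/
def eight_dvd_signature_of_isEven : Prop :=
  ∀ [Module.Finite ℤ V] [Module.Free ℤ V] (hs : Q.IsSymm) (hu : Q.IsUnimodular) (he : Q.IsEven),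
    (8 : ℤ) ∣ Q.signature

/-- **Classification of indefinite unimodular forms** (Serre; Milnor–Husemoller (1973), II Thm 5.3):
two symmetric unimodular indefinite lattices with the same rank, signature and type (parity) are
isometric. Serre, *Cours d'arithmétique* V.2.2 Thm 5 and V.3 Thm 6. [cite: MilnorHusemoller1973] -/
def equivalent_of_isIndefinite : Prop :=
  ∀ [Module.Finite ℤ V] [Module.Free ℤ V] [Module.Finite ℤ V'] [Module.Free ℤ V'] (hs : Q.IsSymm) (hu : Q.IsUnimodular) (hi : Q.IsIndefinite) (hs' : Q'.IsSymm) (hu' : Q'.IsUnimodular) (hi' : Q'.IsIndefinite) (hrank : finrank ℤ V = finrank ℤ V') (hsig : Q.signature = Q'.signature) (heven : Q.IsEven ↔ Q'.IsEven),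
    Q.Equivalent Q'

end LinearMap.BilinForm

namespace Literature.Topology.FourManifolds

open LinearMap.BilinForm

/-- The `E₈` lattice form on `ℤ⁸`: the bilinear form whose Gram matrix in the standard basis is the
Cartan matrix of `E₈` (Mathlib's `CartanMatrix.E₈`). It is symmetric, even, unimodular and positive
definite of signature `8`. Milnor–Husemoller (1973), II §6; Serre, *Cours d'arithmétique* V.1.4.3. [cite: MilnorHusemoller1973] -/
def e8Form : LinearMap.BilinForm ℤ (Fin 8 → ℤ) := Matrix.toBilin' CartanMatrix.E₈

/-- The hyperbolic plane `H` (also written `U`): the bilinear form on `ℤ²` with Gram matrix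
`!![0, 1; 1, 0]`. It is symmetric, even, unimodular, indefinite of signature `0`.
Milnor–Husemoller (1973), I §3 and II §2; Serre, *Cours d'arithmétique* V.1.4.2. [cite: MilnorHusemoller1973] -/
def hyperbolicForm : LinearMap.BilinForm ℤ (Fin 2 → ℤ) := Matrix.toBilin' !![0, 1; 1, 0]

/-- The rank of the `E₈` lattice is `8` (trivial). [folklore] -/
theorem finrank_e8 : finrank ℤ (Fin 8 → ℤ) = 8 := by simp

/-- The `E₈` form is symmetric (the Cartan matrix of `E₈` is symmetric, Mathlib
`CartanMatrix.E₈_transpose`). Milnor–Husemoller (1973), II §6. [cite: MilnorHusemoller1973] -/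
theorem isSymm_e8Form : e8Form.IsSymm := by
  rw [e8Form, Matrix.isSymm_toBilin'_iff_isSymm]
  exact CartanMatrix.E₈_isSymm

/-- The `E₈` form is unimodular (`det E₈ = 1`). Milnor–Husemoller (1973), II §6. [cite: MilnorHusemoller1973] -/
def isUnimodular_e8Form : Prop :=
  e8Form.IsUnimodular

/-- The `E₈` form is even (diagonal Cartan entries are `2`). Milnor–Husemoller (1973), II §6. [cite: MilnorHusemoller1973] -/
theorem isEven_e8Form : e8Form.IsEven := by
  intro x
  simp only [e8Form, Matrix.toBilin'_apply']
  refine ⟨x 0 ^ 2 + x 1 ^ 2 + x 2 ^ 2 + x 3 ^ 2 + x 4 ^ 2 + x 5 ^ 2 + x 6 ^ 2 + x 7 ^ 2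
    - x 0 * x 2 - x 1 * x 3 - x 2 * x 3 - x 3 * x 4 - x 4 * x 5 - x 5 * x 6 - x 6 * x 7, ?_⟩
  simp [CartanMatrix.E₈, Matrix.mulVec, dotProduct, Fin.sum_univ_succ, Matrix.of_apply]
  ring

/-- The `E₈` form is positive definite. Milnor–Husemoller (1973), II §6. [cite: MilnorHusemoller1973] -/
def posDef_e8Form : Prop :=
  e8Form.PosDef

/-- The `E₈` form has signature `8`. Milnor–Husemoller (1973), II §6. [cite: MilnorHusemoller1973] -/
def signature_e8Form : Prop :=
  e8Form.signature = 8

/-- The hyperbolic plane is symmetric. Milnor–Husemoller (1973), I §3. [cite: MilnorHusemoller1973] -/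
theorem isSymm_hyperbolicForm : hyperbolicForm.IsSymm := by
  rw [hyperbolicForm, Matrix.isSymm_toBilin'_iff_isSymm]
  decide

/-- The hyperbolic plane is unimodular (`det = -1`). Milnor–Husemoller (1973), I §3. [cite: MilnorHusemoller1973] -/
def isUnimodular_hyperbolicForm : Prop :=
  hyperbolicForm.IsUnimodular

/-- The hyperbolic plane is even: `H (x, y) (x, y) = 2xy`. Milnor–Husemoller (1973), I §3. [cite: MilnorHusemoller1973] -/
theorem isEven_hyperbolicForm : hyperbolicForm.IsEven := by
  intro x
  simp only [hyperbolicForm, Matrix.toBilin'_apply']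
  refine ⟨x 0 * x 1, ?_⟩
  simp [Matrix.mulVec, dotProduct, Fin.sum_univ_two]
  ring

/-- The hyperbolic plane has signature `0` (`b⁺ = b⁻ = 1`). Milnor–Husemoller (1973), II §2. [cite: MilnorHusemoller1973] -/
def signature_hyperbolicForm : Prop :=
  hyperbolicForm.signature = 0

/-- The hyperbolic plane is indefinite: `(1, 0)` is a nonzero isotropic vector, so `H` is neither
positive nor negative definite. Milnor–Husemoller (1973), II §2. [cite: MilnorHusemoller1973] -/
theorem isIndefinite_hyperbolicForm : hyperbolicForm.IsIndefinite := by
  have h0 : hyperbolicForm (Pi.single 0 1) (Pi.single 0 1) = 0 := by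
    simp [hyperbolicForm, Matrix.toBilin'_apply', Matrix.mulVec, dotProduct, Fin.sum_univ_two]
  have hne : (Pi.single 0 1 : Fin 2 → ℤ) ≠ 0 := by
    intro h
    simpa using congr_fun h 0
  rw [isIndefinite_iff, posDef_iff, negDef_iff]
  exact ⟨fun H ↦ (H _ hne).ne' h0, fun H ↦ (H _ hne).ne h0⟩

end Literature.Topology.FourManifolds

end

/-! ### API for `LinearMap.BilinForm.IsDiagonalizable`

`IsDiagonalizable` is a *predicate* on integral forms (the conclusion of Donaldson's theorem), not
a statement about all lattices. The lemmas below are its basic API — the coordinate formula in an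
orthogonal basis, invariance under isometry and under `Q ↦ -Q` (orientation reversal), the zero
lattice, diagonal Gram matrices `⊕ ⟨dᵢ⟩` — and the standard example showing that the predicate is a
genuine restriction even among unimodular lattices: the hyperbolic plane `H` (Serre's `U`) admits
no orthogonal `ℤ`-basis, since `H` is even (type II) while a form with an orthogonal basis takes
the values `H(x, bⱼ) = xⱼ · H(bⱼ, bⱼ)`; for unimodular `H` this is Serre's remark that `U` and
`I₊ ⊕ I₋` "are of different types" (Serre, *A Course in Arithmetic*, Ch. V, §1.3.4, §1.4.1–1.4.2,
§2.1). -/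

open Module

namespace LinearMap.BilinForm

variable {V V' : Type*} [AddCommGroup V] [Module ℤ V] [AddCommGroup V'] [Module ℤ V']
  {Q : LinearMap.BilinForm ℤ V} {Q' : LinearMap.BilinForm ℤ V'}

/-- Expansion of the second argument of a bilinear form along a basis:
`Q x y = Σⱼ yⱼ · Q x bⱼ` where `yⱼ = b.repr y j`. [folklore] -/
theorem apply_eq_sum_repr {ι : Type*} (b : Basis ι ℤ V) (x y : V) :
    Q x y = (b.repr y).sum fun j c => c * Q x (b j) := by
  conv_lhs => rw [← b.linearCombination_repr y, Finsupp.linearCombination_apply, Finsupp.sum,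
    map_sum]
  refine Finset.sum_congr rfl fun j _ => ?_
  rw [LinearMap.BilinForm.smul_right]

/-- In a `Q`-orthogonal basis `b`, pairing with a basis vector reads off one coordinate:
`Q x bⱼ = xⱼ · Q bⱼ bⱼ` where `xⱼ = b.repr x j`. (Serre, *A Course in Arithmetic*, Ch. V §1.3.4:
in a basis the form is given by its Gram matrix, here diagonal.) [folklore] -/
theorem apply_basis_eq_of_isOrthoᵢ {ι : Type*} {b : Basis ι ℤ V} (hb : LinearMap.IsOrthoᵢ Q b)
    (x : V) (j : ι) : Q x (b j) = b.repr x j * Q (b j) (b j) := by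
  conv_lhs => rw [← b.linearCombination_repr x, Finsupp.linearCombination_apply, Finsupp.sum,
    LinearMap.BilinForm.sum_left]
  rw [Finset.sum_eq_single j]
  · rw [LinearMap.BilinForm.smul_left]
  · intro i _ hij
    have h0 : Q (b i) (b j) = 0 := hb hij
    rw [LinearMap.BilinForm.smul_left, h0, mul_zero]
  · intro hj
    simp [Finsupp.notMem_support_iff.mp hj]

/-- In a `Q`-orthogonal basis every value `Q x bⱼ` is a multiple of the diagonal entry
`Q bⱼ bⱼ`. [folklore] -/
theorem apply_self_dvd_of_isOrthoᵢ {ι : Type*} {b : Basis ι ℤ V} (hb : LinearMap.IsOrthoᵢ Q b)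
    (x : V) (j : ι) : Q (b j) (b j) ∣ Q x (b j) :=
  ⟨b.repr x j, by rw [apply_basis_eq_of_isOrthoᵢ hb, mul_comm]⟩

/-- Diagonalisability over `ℤ` is invariant under isometry: an isometry carries an orthogonal
basis to an orthogonal basis. [folklore] -/
theorem IsDiagonalizable.of_equivalent (h : Q.Equivalent Q') (hQ : Q.IsDiagonalizable) :
    Q'.IsDiagonalizable := by
  obtain ⟨e⟩ := h
  obtain ⟨ι, b, hb⟩ := hQ
  refine ⟨ι, b.map (e : V ≃ₗ[ℤ] V'), fun i j hij => ?_⟩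
  have h0 : Q (b i) (b j) = 0 := hb hij
  simp only [Function.onFun, Basis.map_apply, IsometryEquiv.coe_toLinearEquiv,
    IsometryEquiv.map_app]
  exact h0

/-- Isometric forms are simultaneously diagonalisable over `ℤ` or not. [folklore] -/
theorem isDiagonalizable_iff_of_equivalent (h : Q.Equivalent Q') :
    Q.IsDiagonalizable ↔ Q'.IsDiagonalizable :=
  ⟨IsDiagonalizable.of_equivalent h, IsDiagonalizable.of_equivalent h.symm⟩

variable (Q) in
/-- `-Q` is diagonalisable over `ℤ` iff `Q` is (the same orthogonal basis works); in particular
diagonalisability of an intersection form does not depend on the orientation. [folklore] -/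
theorem isDiagonalizable_neg_iff : (-Q).IsDiagonalizable ↔ Q.IsDiagonalizable := by
  constructor
  · rintro ⟨ι, b, hb⟩
    refine ⟨ι, b, fun i j hij => ?_⟩
    have h0 : (-Q) (b i) (b j) = 0 := hb hij
    simpa only [LinearMap.neg_apply, neg_eq_zero] using h0
  · rintro ⟨ι, b, hb⟩
    refine ⟨ι, b, fun i j hij => ?_⟩
    have h0 : Q (b i) (b j) = 0 := hb hij
    simp only [Function.onFun, LinearMap.neg_apply, h0, neg_zero]

variable (Q) in
/-- The zero lattice is diagonalisable over `ℤ`: the empty family is an orthogonal basis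
(so Donaldson's theorem is consistent on 4-manifolds with `b₂ = 0`). [folklore] -/
theorem isDiagonalizable_of_subsingleton [Subsingleton V] : Q.IsDiagonalizable :=
  ⟨Empty, Basis.empty V, fun i => i.elim⟩

end LinearMap.BilinForm

namespace Literature.Topology.FourManifolds

open LinearMap.BilinForm

/-- A form on `ℤⁿ` whose Gram matrix is diagonal, `⊕ᵢ ⟨dᵢ⟩`, is diagonalisable over `ℤ`: the
standard basis is orthogonal. With `dᵢ = ±1` these are Serre's `s I₊ ⊕ t I₋`
(*A Course in Arithmetic*, Ch. V §1.4.1). [cite: Serre1973, Ch. V §1.4.1] -/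
theorem isDiagonalizable_toBilin'_diagonal {n : Type} [Fintype n] [DecidableEq n] (d : n → ℤ) :
    (Matrix.toBilin' (Matrix.diagonal d)).IsDiagonalizable := by
  refine ⟨n, Pi.basisFun ℤ n, fun i j hij => ?_⟩
  simp only [Function.onFun, Pi.basisFun_apply, Matrix.toBilin'_single,
    Matrix.diagonal_apply_ne _ hij]

/-- The hyperbolic plane `H` is **not** diagonalisable over `ℤ`. In a would-be orthogonal basis
`b`, each `H(bⱼ, bⱼ)` is even (`H` is even, `isEven_hyperbolicForm`), hence so is every
`H(x, bⱼ) = xⱼ H(bⱼ, bⱼ)` (`apply_basis_eq_of_isOrthoᵢ`) and, expanding `y`, every `H(x, y)`;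
but `H(e₀, e₁) = 1`. For the unimodular diagonal forms this is Serre's remark that `U` and
`I₊ ⊕ I₋` have the same rank and index but "are of different types", `U` being of type II and
`s I₊ ⊕ t I₋` of type I (*A Course in Arithmetic*, Ch. V §1.4.1–1.4.2 and §2.1, note after
Thm 1 Cor. 2); the statement here excludes any orthogonal `ℤ`-basis. In particular
`LinearMap.BilinForm.IsDiagonalizable` is a proper predicate (it fails for some unimodular
lattice), not a property of all lattices. [cite: Serre1973, Ch. V §2.1] -/
theorem not_isDiagonalizable_hyperbolicForm : ¬ hyperbolicForm.IsDiagonalizable := by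
  rintro ⟨ι, b, hb⟩
  have h1 : ∀ (x : Fin 2 → ℤ) (j : ι), Even (hyperbolicForm x (b j)) := fun x j => by
    rw [apply_basis_eq_of_isOrthoᵢ hb]
    exact (isEven_hyperbolicForm (b j)).mul_left _
  have h2 : ∀ x y : Fin 2 → ℤ, Even (hyperbolicForm x y) := fun x y => by
    rw [apply_eq_sum_repr b x y, Finsupp.sum]
    exact Finset.even_sum _ fun j _ => (h1 x j).mul_left _
  have h3 : hyperbolicForm (Pi.single 0 1) (Pi.single 1 1) = 1 := by
    rw [hyperbolicForm, Matrix.toBilin'_single]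
    rfl
  exact Int.not_even_one (h3 ▸ h2 _ _)

/-- Hence the hyperbolic plane is not isometric to any diagonal form `⊕ᵢ ⟨dᵢ⟩` on `ℤⁿ`, in
particular not to `I₊ ⊕ I₋` although both are unimodular of rank `2` and signature `0`
(Serre, *A Course in Arithmetic*, Ch. V §2.1, note after Thm 1 Cor. 2). [cite: Serre1973, Ch. V §2.1] -/
theorem not_equivalent_hyperbolicForm_toBilin'_diagonal {n : Type} [Fintype n] [DecidableEq n]
    (d : n → ℤ) : ¬ hyperbolicForm.Equivalent (Matrix.toBilin' (Matrix.diagonal d)) := fun h =>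
  not_isDiagonalizable_hyperbolicForm
    ((isDiagonalizable_iff_of_equivalent h).mpr (isDiagonalizable_toBilin'_diagonal d))

end Literature.Topology.FourManifolds
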